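import Literature.AnabelianGeometry.EtaleTheta.ThetaSettingOriginClauses
import Literature.AnabelianGeometry.EtaleTheta.Discharge.Sec1Thm110iUniqueCapstone
import Literature.AnabelianGeometry.EtaleTheta.Discharge.Sec1Thm110iUniqueOfDictionary
import HarnessLib

/-!
# [EtTh] Thm. 1.10 (i) «up to ±1» at the model — the parity binder read off the ORIGIN PREDICATE
# (abc-iut-L2-t6 gen 5; the two one-line packagings announced in this seat's gen-4 HANDOFF)

S. Mochizuki, *The étale theta function and its Frobenioid-theoretic manifestations*, Publ. RIMS **45**
(2009), §1: Def. 1.7 p. 27 (the characterisation of `ε_μ` «the unique nontrivial element of `Gal(Ẍ/X)`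
that acts trivially on the set of irreducible components of the special fiber»), Def. 1.9 p. 29,
Thm. 1.10 (i) p. 30 (printed 253, 255, 256) [cite: MochizukiEtTh2009, Thm 1.10 (i) p.30].
Layer L2 of the abc-iut cell. PROOF-ONLY (no `def`): the K2 junction
`MuTwoSetting.thm110iUnique_of_referenceClass_of_prop15ii` (p420097) and the K2 capstone
`MuTwoSetting.thm110iUnique_of_translateValues` (p422518) both carry the binder «a lift `σ_Z` of the
admissible `ε_Z` has ODD `toZ`» (= the orbit-generator clause (B2), GAP row G-L2t6g4-3, certified
INDEPENDENT of the bare interface by abc-iut-w5-d140's `SettingModel.exists_admissible_not_orbitGenerator`,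
p423686). At an ORIGIN of the Def. 1.7 setting — `MuTwoSetting.IsDef17Origin` (p421622), whose field
`epsMu_mem_sup` is the printed characterisation of `ε_μ` — that binder is a THEOREM
(`IsDef17Origin.odd_toZ_of_isAdmissibleEpsZ`), so both results hold with the parity hypotheses replaced
by `h : M.IsDef17Origin`. Nothing else changes: the remaining hypotheses are t1's FACT `Prop15ii`
(F-2503), the branch sign `s = ±1` (F-L2t6g4-1), a reference theta class `κ₀`, and the evaluation
binders of the respective parent theorem (points over `τ^{±1}` with natural evaluation and the
reference-class law at them, resp. the translate value law at `τ^{±1}`).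
HONEST FRAMING: conditional packaging at the model; `IsDef17Origin` is a predicate to be INHABITED at a
genuine model, never asserted (at the cell's root model the parity clause holds —
`SettingModel.model_exists_orbitGenerator` — while `IsThm16Origin` fails, abc-iut-w5-d051 p424726);
typed ≠ proved for [EtTh]; nothing here bears on the disputed [IUTchIII] Cor. 3.12.
-/

noncomputable section

namespace Literature.AnabelianGeometry.EtaleTheta

open Literature.AnabelianGeometry.SemiGraphs

namespace MuTwoSetting.IsDef17Origin

variable {p : ℕ} [Fact p.Prime] {M : MuTwoSetting p}

/-- **Thm. 1.10 (i) uniqueness at an origin of the Def. 1.7 setting, from the reference-class law on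
the points used** — the K2 junction `thm110iUnique_of_referenceClass_of_prop15ii` (p420097) with its
parity binder discharged by `IsDef17Origin` (the printed characterisation of `ε_μ`, Def. 1.7 p. 27):
hypotheses = FACT `Prop15ii`, a reference theta class `κ₀`, the branch sign `s = ±1`, and for the
generator `σ₁` of `Π^tp_Ẋ/Π^tp_Ÿ` the points over `τ^{±1}` with natural evaluation, prescribed
coordinates `(s q̈)^a √−1^{±1}` and the law «`κ₀` evaluates to `Θ̈(Ü)`» at them.
[cite: MochizukiEtTh2009, Thm 1.10 (i) p.30] -/
theorem thm110iUnique_of_referenceClass (h : M.IsDef17Origin) (hC : M.toThetaSetting.Compat)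
    {εZ : M.GtpC} (hZ : M.IsAdmissibleEpsZ εZ) (E : M.toThetaSetting.EtaleThetaData)
    (S : M.StandardData E.toKummerData) (h15ii : ThetaSetting.Prop15ii E.toKummerData hC)
    {κ₀ : M.toThetaSetting.H1 M.toThetaSetting.GtpYdd} (hκ₀mem : κ₀ ∈ E.thetaClasses)
    {s : PadicAlgCl p} (hs : s = 1 ∨ s = -1)
    (hpts : haveI := hC.GtpYdd_normal
      ∀ σ₁ : M.PiTemp, M.inclX σ₁ ∈ M.dotX εZ → Multiplicative.toAdd (M.toZ σ₁) = 1 →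
      ∃ (τ_ τ'_ : ℤ → ThetaSetting.NonCuspidalPoint E.toKummerData),
        (∀ a : ℤ, S.tau.evalAt (ContH1.res M.toTheta M.toThetaSetting.DeltaTheta S.tau.Dpt_le
            (ContH1.conj M.toTheta M.toThetaSetting.DeltaTheta (σ₁ ^ a) E.etaDd)) =
          (τ_ a).evalAt (ContH1.res M.toTheta M.toThetaSetting.DeltaTheta (τ_ a).Dpt_le E.etaDd)) ∧
        (∀ a : ℤ, S.tauInv.evalAt (ContH1.res M.toTheta M.toThetaSetting.DeltaTheta S.tauInv.Dpt_le
            (ContH1.conj M.toTheta M.toThetaSetting.DeltaTheta (σ₁ ^ a) E.etaDd)) =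
          (τ'_ a).evalAt (ContH1.res M.toTheta M.toThetaSetting.DeltaTheta (τ'_ a).Dpt_le E.etaDd)) ∧
        (∀ a : ℤ, (((τ_ a).coord : M.Kdd) : PadicAlgCl p) =
          (s * M.toThetaSetting.qdd) ^ a * S.sqrtNegOne) ∧
        (∀ a : ℤ, (((τ'_ a).coord : M.Kdd) : PadicAlgCl p) =
          (s * M.toThetaSetting.qdd) ^ a * S.sqrtNegOne⁻¹) ∧
        (∀ a : ℤ, ∃ v : (↥M.Kdd)ˣ, ((v : M.Kdd) : PadicAlgCl p) =
            thetaDdot M.toThetaSetting.qdd (((τ_ a).coord : M.Kdd) : PadicAlgCl p) ∧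
          (τ_ a).evalAt (ContH1.res M.toTheta M.toThetaSetting.DeltaTheta (τ_ a).Dpt_le κ₀) =
            E.toKddHat v) ∧
        (∀ a : ℤ, ∃ v : (↥M.Kdd)ˣ, ((v : M.Kdd) : PadicAlgCl p) =
            thetaDdot M.toThetaSetting.qdd (((τ'_ a).coord : M.Kdd) : PadicAlgCl p) ∧
          (τ'_ a).evalAt (ContH1.res M.toTheta M.toThetaSetting.DeltaTheta (τ'_ a).Dpt_le κ₀) =
            E.toKddHat v)) :
    Thm110iUnique hC hZ E S := by
  obtain ⟨σZ, hσZ⟩ := hZ.1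
  exact MuTwoSetting.thm110iUnique_of_referenceClass_of_prop15ii hC hZ E S h15ii hκ₀mem hσZ
    (h.odd_toZ_of_isAdmissibleEpsZ hZ hσZ) hs hpts

/-- **Thm. 1.10 (i) uniqueness at an origin of the Def. 1.7 setting, from the TRANSLATE VALUE LAW at
`τ^{±1}`** — the K2 capstone `MuTwoSetting.thm110iUnique_of_translateValues` (p422518: the points over
`τ^{±1}` CONSTRUCTED with natural evaluation, abc-iut-L2-d1 p420910) with its parity binder discharged
by `IsDef17Origin`: hypotheses = FACT `Prop15ii`, `κ₀`, `s = ±1`, unit families `w`, `w'` with the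
prescribed coordinates, and ONE printed sentence — for the generator `σ₁` the class `conj(σ₁^a) κ₀`
evaluates at `τ` / `τ⁻¹` to `Θ̈((s q̈)^a √−1)` / `Θ̈((s q̈)^a (√−1)⁻¹)` (Prop. 1.4 (ii)+(iii) at the
class level). [cite: MochizukiEtTh2009, Thm 1.10 (i) p.30] -/
theorem thm110iUnique_of_translateValues (h : M.IsDef17Origin) (hC : M.toThetaSetting.Compat)
    {εZ : M.GtpC} (hZ : M.IsAdmissibleEpsZ εZ) (E : M.toThetaSetting.EtaleThetaData)
    (S : M.StandardData E.toKummerData) (h15ii : ThetaSetting.Prop15ii E.toKummerData hC)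
    {κ₀ : M.toThetaSetting.H1 M.toThetaSetting.GtpYdd} (hκ₀mem : κ₀ ∈ E.thetaClasses)
    {s : PadicAlgCl p} (hs : s = 1 ∨ s = -1)
    (w w' : ℤ → (↥M.Kdd)ˣ)
    (hw : ∀ a : ℤ, ((w a : M.Kdd) : PadicAlgCl p) = (s * M.toThetaSetting.qdd) ^ a * S.sqrtNegOne)
    (hw' : ∀ a : ℤ, ((w' a : M.Kdd) : PadicAlgCl p) =
      (s * M.toThetaSetting.qdd) ^ a * S.sqrtNegOne⁻¹)
    (htv : haveI := hC.GtpYdd_normal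
      ∀ σ₁ : M.PiTemp, M.inclX σ₁ ∈ M.dotX εZ → Multiplicative.toAdd (M.toZ σ₁) = 1 →
      ∀ a : ℤ, ∃ v : (↥M.Kdd)ˣ, ((v : M.Kdd) : PadicAlgCl p) =
          thetaDdot M.toThetaSetting.qdd ((s * M.toThetaSetting.qdd) ^ a * S.sqrtNegOne) ∧
        S.tau.evalAt (ContH1.res M.toTheta M.toThetaSetting.DeltaTheta S.tau.Dpt_le
          (ContH1.conj M.toTheta M.toThetaSetting.DeltaTheta (σ₁ ^ a) κ₀)) = E.toKddHat v)
    (htv' : haveI := hC.GtpYdd_normal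
      ∀ σ₁ : M.PiTemp, M.inclX σ₁ ∈ M.dotX εZ → Multiplicative.toAdd (M.toZ σ₁) = 1 →
      ∀ a : ℤ, ∃ v : (↥M.Kdd)ˣ, ((v : M.Kdd) : PadicAlgCl p) =
          thetaDdot M.toThetaSetting.qdd ((s * M.toThetaSetting.qdd) ^ a * S.sqrtNegOne⁻¹) ∧
        S.tauInv.evalAt (ContH1.res M.toTheta M.toThetaSetting.DeltaTheta S.tauInv.Dpt_le
          (ContH1.conj M.toTheta M.toThetaSetting.DeltaTheta (σ₁ ^ a) κ₀)) = E.toKddHat v) :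
    Thm110iUnique hC hZ E S := by
  obtain ⟨σZ, hσZ⟩ := hZ.1
  exact MuTwoSetting.thm110iUnique_of_translateValues hC hZ E S h15ii hκ₀mem hσZ
    (h.odd_toZ_of_isAdmissibleEpsZ hZ hσZ) hs w w' hw hw' htv htv'

end MuTwoSetting.IsDef17Origin

end Literature.AnabelianGeometry.EtaleTheta

end
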